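import Literature.NumberTheory.GaloisRepresentations.PontryaginTateDualInverseLimitScalars
import Literature.NumberTheory.GaloisRepresentations.LocalTatePairingLevelChange
import Literature.NumberTheory.GaloisRepresentations.ContinuousCohomologyCoefficientColimit
import Literature.NumberTheory.GaloisRepresentations.AbsGaloisGroupCompact
import Literature.NumberTheory.GaloisCohomology.PoitouTate
import HarnessLib

/-!
# The `Λ`-adic local pairing `H¹(K_v, D) × H¹_cont(K_v, T*) → ℚ/ℤ` of an exhausted discrete
# Galois module and its compact Tate dual, through the finite levels (Greenberg 2010 (5), (9))

Topic `NumberTheory/GaloisRepresentations`; namespace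
`Literature.NumberTheory.GaloisRepresentations.DiscreteGaloisModule.TorsionLayers` (extends the
`E.`-API of `PontryaginTateDualInverseLimit(Scalars).lean`).  Definitions WITH BODIES and theorems;
no named fact, no `sorry`, no instance, no notation.  Lane «SUR-Λ» of cell `bsd-eis` (road memo
`SUR-LAMBDA-ROAD-w5g9.md`, the shared local infrastructure of bricks C4/C5/C6),
`--supports stmt-BirchSwinnertonDyer-19032`.

MATHEMATICS.  R. Greenberg, *Surjectivity of the global-to-local map defining a Selmer group*,
Kyoto J. Math. 50 (2010): §2 (5) "the local pairings `H¹(K_v, D) × H¹(K_v, T*) → ℚ_p/ℤ_p`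
(Tate local duality)" and §3.1 (9) "`P(K, D) × P(K, T*) → ℚ_p/ℤ_p` … defined by the local
pairings (5)", for a discrete `p`-primary `D = ⋃_k D_k` and its compact dual
`T* = Hom(D, μ_{p^∞}) = lim_k Hom(D_k, μ_{p^k})`.  Here `D` carries torsion layers
`E : τ.TorsionLayers p` (an exhaustive chain of finite `Γ_K`-stable `D_k` with `p^k D_k = 0`),
`T* = E.dualSystem.limitRep`, and at a place `v` of the number field `K` the pairing is ASSEMBLED
FROM THE FINITE LEVELS for an arbitrary family `inv k : LocalInvariants K (p^k)` of local invariant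
maps (the intended one is THE canonical family `LocalInvariants.canonical K (p^k)`, whose
level-change law is the tree's `canonical_map_muIncl`):

* `E.localDualSystem v` (the dual tower over `Γ_{K_v}`, `DiscreteInvSystem.comap`; so
  `H¹_cont(K_v, T*) = continuousCohomology 1 (E.localDualSystem v).limitRep.toTopRep`), its level
  components `E.localProj v k`, and `E.localSubtypeMap v k = (D_k ⊆ D)_*`, `E.localInclMap v h`
  on `H¹(K_v, ·)` (with `H¹(K_v, D) = ⋃ im (D_k ⊆ D)_*`, dies/agree-deeper along the ℕ-chain, from
  the tree's `ContinuousRep.exists_cohomologyMap_eq_one/_eq_zero_one`);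
* `E.levelPairing inv v k : H¹(K_v, D_k) →+ H¹_cont(K_v, T*) →+ ℚ/ℤ`, `(t', y) ↦ ι_{p^k} ⟨t', y_k⟩`
  (`localTatePairingZMod` for `inv k v`, read in `ℚ/ℤ` by `zmodToQmodZ`; no hypothesis); under
  the LEVEL-CHANGE LAW `InvLevelLaw inv v` it is compatible with the layer inclusions
  (`levelPairing_localInclMap`, = the tree's `zmodToQmodZ_localTatePairingZMod_map_eq_of_levelChange`
  + `muInclusion_dualRes_apply`) and depends only on the class in `H¹(K_v, D)`;
* **`E.limitPairing inv v hinv : H¹(K_v, D) →+ H¹_cont(K_v, T*) →+ ℚ/ℤ`**, the pairing (5), with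
  the LEVEL FORMULA `limitPairing_localSubtypeMap : ⟪(D_k ⊆ D)_* t', y⟫ = ι_{p^k} ⟨t', y_k⟩_{p^k}`;
* `E.dualLocalCondition inv v L = L^⊥ ≤ H¹_cont(K_v, T*)` (Greenberg's `L(K_v, T*)`, §3.1);
* RIGHT NON-DEGENERACY at a finite place (`eq_zero_of_forall_limitPairing_eq_zero`): if every
  `inv k` is perfect at the finite places (`LocalInvariants.IsPerfect`; `canonical_isPerfect`) then
  `(∀ t, ⟪t, y⟫ = 0) → y = 0` (levelwise perfectness + injectivity of `ι_{p^k}` and of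
  `H¹_cont(K_v, T*) → lim_k H¹(K_v, Hom(D_k, μ_{p^k}))`, `DiscreteInvSystem.toCohomologyLimit₁_injective`).
The adjointness `⟪θ_* t, y⟫ = ⟪t, θ̂_* y⟫` for layer-preserving endomorphisms is in the sequel.

HONESTY: infrastructure (Tate local duality is consumed levelwise through `inv`, nothing of it is
proved here); no statement about Selmer groups, Greenberg's propositions or BSD is proved.  AI
formalisation, weaker than expert review; the statements are established only by the kernel check.

## References
* R. Greenberg, *Surjectivity of the global-to-local map defining a Selmer group*, Kyoto J. Math.
  50 (2010) 853–888, §2 (5) p. 6, §3.1 (9) p. 14. [Greenberg2010]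
* J. S. Milne, *Arithmetic Duality Theorems*, 2nd ed. (2006), I Cor. 2.3, I §0 (limits of
  pairings). [MilneADT2006]
* J.-P. Serre, *Local Fields* (1979), XIII §3 Cor. 3 (invariants under change of level).
  [SerreLocalFields1979]
-/

noncomputable section

open Function CategoryTheory NumberField IsDedekindDomain Field
open _root_.TopRep _root_.ContRepresentation _root_.ContinuousCohomology
open scoped ContRepresentation
open Literature.NumberTheory.GaloisRepresentations.DiscreteGaloisModule
open Literature.NumberTheory.GaloisCohomology (LocalInvariants)
open Literature.AnabelianGeometry.AbsoluteAnabelian.Prop121vii (zmodToQmodZ zmodToQmodZ_injective)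

namespace Literature.NumberTheory.GaloisRepresentations

namespace DiscreteGaloisModule.TorsionLayers

variable {K : Type} [Field K] [NumberField K] {D : Type} [AddCommGroup D] [TopologicalSpace D]
  [DiscreteTopology D] {τ : DiscreteGaloisModule K D} {p : ℕ} (E : τ.TorsionLayers p)
  (inv : ∀ k : ℕ, LocalInvariants K (p ^ k)) (v : Place K)

/-! ### §1. The dual tower over `Γ_{K_v}` and the level components of `H¹_cont(K_v, T*)` -/

/-- The dual tower `(Hom(D_k, μ_{p^k}))_k` restricted to the decomposition group `Γ_{K_v} → Γ_K`;
its limit representation is `T*|_{Γ_{K_v}}` (`DiscreteInvSystem.comap_limitRep`).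
[cite: Greenberg2010, §2 p. 6 L1–12] -/
abbrev localDualSystem : DiscreteInvSystem (absoluteGaloisGroup (Place.Completion v)) E.LayerDual :=
  E.dualSystem.comap (absGaloisRestrict K (Place.Completion v))

/-- **The level-`k` component `y ↦ y_k : H¹_cont(K_v, T*) → H¹(K_v, Hom(D_k, μ_{p^k}))`**
(`H¹` of the projection `T* → Hom(D_k, μ_{p^k})`; the `k`-th coordinate of the comparison
`H¹_cont(K_v, T*) ≅ lim_k H¹(K_v, Hom(D_k, μ_{p^k}))`). [cite: Greenberg2010, §2 p. 6 L1–12] -/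
def localProj (k : ℕ) :
    continuousCohomology 1 (E.localDualSystem v).limitRep.toTopRep →+
      galoisCohomology ((E.layerDualRep k).toLocal v) 1 :=
  (cohomologyMap ((E.localDualSystem v).projHom k) 1).hom.toLinearMap.toAddMonoidHom

/-- Unfolding `localProj`. [cite: Greenberg2010, §2 p. 6 L1–12] -/
theorem localProj_apply (k : ℕ) (y : continuousCohomology 1 (E.localDualSystem v).limitRep.toTopRep) :
    E.localProj v k y = cohomologyMap ((E.localDualSystem v).projHom k) 1 y := rfl

/-- The level components are compatible with the transition maps: `(y_m)|_{D_n} = y_n` for `n ≤ m`.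
[cite: NeukirchSchmidtWingberg2008, II §7 Thm 2.7.5] -/
theorem map_dualRes_localProj {n m : ℕ} (h : n ≤ m)
    (y : continuousCohomology 1 (E.localDualSystem v).limitRep.toTopRep) :
    cohomologyMap ((E.localDualSystem v).redHom h) 1 (E.localProj v m y) = E.localProj v n y :=
  ((E.localDualSystem v).toCohomologyLimit₁ y).2 h

/-! ### §2. Every class of `H¹(K_v, D)` comes from a level `D_k` -/

/-- The inclusion `D_k ⊆ D` as a morphism of discrete `Γ_K`-modules. [cite: Greenberg2010, §2 p. 6 L1–12] -/
abbrev layerSubtypeHom (k : ℕ) : (E.layerRep k).toTopRep ⟶ τ.toTopRep :=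
  TopRep.ofHom ⟨(E.N k).subtypeL, fun σ => by ext x; rfl⟩

/-- **`(D_k ⊆ D)_* : H¹(K_v, D_k) →+ H¹(K_v, D)`** (stated on the `toLocal` modules, so that it composes
syntactically with the tree's local API). [cite: Greenberg2010, §3.1 p. 14] -/
def localSubtypeMap (k : ℕ) :
    galoisCohomology ((E.layerRep k).toLocal v) 1 →+ galoisCohomology (τ.toLocal v) 1 :=
  galoisCohomology.map (ρ := (E.layerRep k).toLocal v) (ρ' := τ.toLocal v)
    ((E.layerSubtypeHom k).hom.restrictField (Place.Completion v)) 1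

/-- **`(D_k ⊆ D_m)_* : H¹(K_v, D_k) →+ H¹(K_v, D_m)`** for `k ≤ m`. [cite: Greenberg2010, §3.1 p. 14] -/
def localInclMap {k m : ℕ} (h : k ≤ m) :
    galoisCohomology ((E.layerRep k).toLocal v) 1 →+ galoisCohomology ((E.layerRep m).toLocal v) 1 :=
  galoisCohomology.map (ρ := (E.layerRep k).toLocal v) (ρ' := (E.layerRep m).toLocal v)
    ((E.layerInclHom h).hom.restrictField (Place.Completion v)) 1

/-- Unfolding `localSubtypeMap` as the tree's `cohomologyMap` of the restricted inclusion.
[cite: Greenberg2010, §3.1 p. 14] -/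
theorem localSubtypeMap_apply (k : ℕ) (t' : galoisCohomology ((E.layerRep k).toLocal v) 1) :
    E.localSubtypeMap v k t' = cohomologyMap (TopRep.ofHom
      ⟨((E.layerSubtypeHom k).hom.restrictField (Place.Completion v)).toContinuousLinearMap,
        ((E.layerSubtypeHom k).hom.restrictField (Place.Completion v)).isIntertwining'⟩ :
      ((E.layerRep k).toLocal v).toTopRep ⟶ (τ.toLocal v).toTopRep) 1 t' := rfl

/-- Unfolding `localInclMap` as the tree's `cohomologyMap`. [cite: Greenberg2010, §3.1 p. 14] -/
theorem localInclMap_apply {k m : ℕ} (h : k ≤ m) (t' : galoisCohomology ((E.layerRep k).toLocal v) 1) :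
    E.localInclMap v h t' = cohomologyMap (TopRep.ofHom
      ⟨((E.layerInclHom h).hom.restrictField (Place.Completion v)).toContinuousLinearMap,
        ((E.layerInclHom h).hom.restrictField (Place.Completion v)).isIntertwining'⟩ :
      ((E.layerRep k).toLocal v).toTopRep ⟶ ((E.layerRep m).toLocal v).toTopRep) 1 t' := rfl

/-- **`H¹(K_v, D) = ⋃_k im H¹(K_v, D_k)`**: every local class comes from some level (`Γ_{K_v}` is
compact and `D` discrete: the tree's `ContinuousRep.exists_cohomologyMap_eq_one` for the chain
`(D_k)`). [cite: Greenberg2010, §3.1 p. 14] [cite: SerreGaloisCohomology1997, I §2.2 Prop. 8] -/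
theorem exists_localSubtypeMap_eq (t : galoisCohomology (τ.toLocal v) 1) :
    ∃ (k : ℕ) (t' : galoisCohomology ((E.layerRep k).toLocal v) 1), E.localSubtypeMap v k t' = t := by
  haveI : CompactSpace (absoluteGaloisGroup (Place.Completion v)) := absoluteGaloisGroup_compactSpace _
  obtain ⟨k, y, hy⟩ := (τ.toLocal v).exists_cohomologyMap_eq_one E.N (fun k _ => E.stable k _)
    E.mono.directed_le E.exhaustive t
  exact ⟨k, y, hy (TopRep.ofHom
    ⟨((E.layerSubtypeHom k).hom.restrictField (Place.Completion v)).toContinuousLinearMap,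
      ((E.layerSubtypeHom k).hom.restrictField (Place.Completion v)).isIntertwining'⟩) fun _ => rfl⟩

/-- Transition compatibility on `H¹(K_v, ·)`: `(D_m ⊆ D)_* ∘ (D_k ⊆ D_m)_* = (D_k ⊆ D)_*`.
[cite: SerreGaloisCohomology1997, I §2.4] -/
theorem localSubtypeMap_localInclMap {k m : ℕ} (h : k ≤ m)
    (t' : galoisCohomology ((E.layerRep k).toLocal v) 1) :
    E.localSubtypeMap v m (E.localInclMap v h t') = E.localSubtypeMap v k t' :=
  ContinuousRep.cohomologyMap_comp_apply_of_eq_one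
    (σ := (E.layerRep k).toLocal v) (σ' := (E.layerRep m).toLocal v) (ρ := τ.toLocal v)
    (TopRep.ofHom ⟨((E.layerInclHom h).hom.restrictField (Place.Completion v)).toContinuousLinearMap,
      ((E.layerInclHom h).hom.restrictField (Place.Completion v)).isIntertwining'⟩)
    (TopRep.ofHom ⟨((E.layerSubtypeHom m).hom.restrictField (Place.Completion v)).toContinuousLinearMap,
      ((E.layerSubtypeHom m).hom.restrictField (Place.Completion v)).isIntertwining'⟩)
    (TopRep.ofHom ⟨((E.layerSubtypeHom k).hom.restrictField (Place.Completion v)).toContinuousLinearMap,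
      ((E.layerSubtypeHom k).hom.restrictField (Place.Completion v)).isIntertwining'⟩)
    (fun _ => rfl) t'

/-- Transitions compose: `(D_{k'} ⊆ D_m)_* ∘ (D_k ⊆ D_{k'})_* = (D_k ⊆ D_m)_*`, the first map given by
ANY submodule inclusion `D_k ≤ D_{k'}` (as produced by the tree's directed-family lemmas).
[cite: SerreGaloisCohomology1997, I §2.4] -/
theorem localInclMap_cohomologyMap_inclusion {k k' m : ℕ} (hkk' : E.N k ≤ E.N k') (hk'm : k' ≤ m)
    (hkm : k ≤ m) (t' : galoisCohomology ((E.layerRep k).toLocal v) 1) :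
    E.localInclMap v hk'm
        (cohomologyMap (TopRep.ofHom ⟨⟨Submodule.inclusion hkk', continuous_of_discreteTopology⟩,
            fun σ => by ext x; rfl⟩ :
          ((E.layerRep k).toLocal v).toTopRep ⟶ ((E.layerRep k').toLocal v).toTopRep) 1 t') =
      E.localInclMap v hkm t' :=
  ContinuousRep.cohomologyMap_comp_apply_of_eq_one
    (σ := (E.layerRep k).toLocal v) (σ' := (E.layerRep k').toLocal v) (ρ := (E.layerRep m).toLocal v)
    (TopRep.ofHom ⟨⟨Submodule.inclusion hkk', continuous_of_discreteTopology⟩, fun σ => by ext x; rfl⟩)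
    (TopRep.ofHom ⟨((E.layerInclHom hk'm).hom.restrictField (Place.Completion v)).toContinuousLinearMap,
      ((E.layerInclHom hk'm).hom.restrictField (Place.Completion v)).isIntertwining'⟩)
    (TopRep.ofHom ⟨((E.layerInclHom hkm).hom.restrictField (Place.Completion v)).toContinuousLinearMap,
      ((E.layerInclHom hkm).hom.restrictField (Place.Completion v)).isIntertwining'⟩)
    (fun _ => rfl) t'

/-- **Dies-deeper along the ℕ-chain**: a class of `H¹(K_v, D_k)` vanishing in `H¹(K_v, D)` vanishes in
`H¹(K_v, D_m)` for some `m ≥ k` (the tree's `ContinuousRep.exists_cohomologyMap_eq_zero_one`, moved to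
an ℕ-level above by monotonicity). [cite: SerreGaloisCohomology1997, I §2.2 Prop. 8] -/
theorem exists_localInclMap_eq_zero {k : ℕ} (t' : galoisCohomology ((E.layerRep k).toLocal v) 1)
    (h0 : E.localSubtypeMap v k t' = 0) :
    ∃ (m : ℕ) (hkm : k ≤ m), E.localInclMap v hkm t' = 0 := by
  obtain ⟨j, hkj, hj⟩ := (τ.toLocal v).exists_cohomologyMap_eq_zero_one E.N (fun k _ => E.stable k _)
    E.mono.directed_le E.exhaustive t'
    (TopRep.ofHom ⟨((E.layerSubtypeHom k).hom.restrictField (Place.Completion v)).toContinuousLinearMap,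
      ((E.layerSubtypeHom k).hom.restrictField (Place.Completion v)).isIntertwining'⟩) (fun _ => rfl) h0
  have hj' := hj (TopRep.ofHom ⟨⟨Submodule.inclusion hkj, continuous_of_discreteTopology⟩,
    fun σ => by ext x; rfl⟩) (fun _ => rfl)
  refine ⟨max k j, le_max_left _ _, ?_⟩
  rw [← E.localInclMap_cohomologyMap_inclusion v hkj (le_max_right k j) (le_max_left k j) t']
  exact (congrArg (E.localInclMap v (le_max_right k j)) hj').trans (map_zero _)

/-- **Agree-deeper along the ℕ-chain**: two level classes with the same image in `H¹(K_v, D)` agree in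
`H¹(K_v, D_m)` for some `m` above both levels. [cite: SerreGaloisCohomology1997, I §2.2 Prop. 8] -/
theorem exists_localInclMap_eq {k k' : ℕ} (t' : galoisCohomology ((E.layerRep k).toLocal v) 1)
    (t'' : galoisCohomology ((E.layerRep k').toLocal v) 1)
    (h : E.localSubtypeMap v k t' = E.localSubtypeMap v k' t'') :
    ∃ (m : ℕ) (hkm : k ≤ m) (hk'm : k' ≤ m), E.localInclMap v hkm t' = E.localInclMap v hk'm t'' := by
  have h0 : E.localSubtypeMap v (max k k')
      (E.localInclMap v (le_max_left k k') t' - E.localInclMap v (le_max_right k k') t'') = 0 := by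
    rw [map_sub, localSubtypeMap_localInclMap, localSubtypeMap_localInclMap, h, sub_self]
  obtain ⟨m, hm₀, hm⟩ := E.exists_localInclMap_eq_zero v _ h0
  refine ⟨m, (le_max_left k k').trans hm₀, (le_max_right k k').trans hm₀, ?_⟩
  rw [map_sub, sub_eq_zero] at hm
  rw [← E.localInclMap_cohomologyMap_inclusion v (E.mono (le_max_left k k')) hm₀
      ((le_max_left k k').trans hm₀) t',
    ← E.localInclMap_cohomologyMap_inclusion v (E.mono (le_max_right k k')) hm₀
      ((le_max_right k k').trans hm₀) t'']
  exact hm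

/-! ### §3. The level-`k` pairing `(t', y) ↦ ι_{p^k} ⟨t', y_k⟩_{p^k}`; independence of the representative -/

variable [NeZero p]

/-- **The level-`k` local pairing read in `ℚ/ℤ`**: for `t' ∈ H¹(K_v, D_k)` and `y ∈ H¹_cont(K_v, T*)`,
`ι_{p^k} (inv_k (t' ∪ y_k)) ∈ ℚ/ℤ`, where `⟨·,·⟩` is the local Tate pairing of `D_k` and
`Hom(D_k, μ_{p^k})` for the family `inv k` (`localTatePairingZMod`) and `ι_{p^k} : ℤ/p^k ↪ ℚ/ℤ`
(`zmodToQmodZ`). [cite: Greenberg2010, §2 (5) p. 6] -/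
def levelPairing (k : ℕ) :
    galoisCohomology ((E.layerRep k).toLocal v) 1 →+
      continuousCohomology 1 (E.localDualSystem v).limitRep.toTopRep →+ AddCircle (1 : ℚ) :=
  haveI := E.finite k
  ((localTatePairingZMod (E.layerRep k) (p ^ k) v (inv k v)).compl₂ (E.localProj v k)).compr₂
    (zmodToQmodZ (p ^ k))

/-- Unfolding `levelPairing`. [cite: Greenberg2010, §2 (5) p. 6] -/
theorem levelPairing_apply (k : ℕ) (t' : galoisCohomology ((E.layerRep k).toLocal v) 1)
    (y : continuousCohomology 1 (E.localDualSystem v).limitRep.toTopRep) :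
    E.levelPairing inv v k t' y =
      haveI := E.finite k
      zmodToQmodZ (p ^ k) (localTatePairingZMod (E.layerRep k) (p ^ k) v (inv k v) t'
        (E.localProj v k y)) := rfl

/-- **The level-change law for the family `inv` at the place `v`**: for `k ≤ k'` and every
intertwining realisation `j` of `μ_{p^k} ⊆ μ_{p^{k'}}`, `inv_{k'} (j_* z) = (p^{k'}/p^k) · inv_k z` on
`H²(K_v, μ_{p^k})` (Serre XIII §3 Cor. 3 for THE invariant maps; the tree's `canonical_map_muIncl`
for `LocalInvariants.canonical`). A `Prop`-valued predicate, not a named fact.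
[cite: SerreLocalFields1979, XIII §3 Cor. 3] -/
def InvLevelLaw : Prop :=
  ∀ ⦃k k' : ℕ⦄ (h : k ≤ k')
    (j : (mu K (p ^ k)).toContRepresentation →ⁱL (mu K (p ^ k')).toContRepresentation),
    (∀ ζ : MuCarrier K (p ^ k), j ζ = muInclusion K (pow_dvd_pow p h) ζ) →
    ∀ z : galoisCohomology ((mu K (p ^ k)).toLocal v) 2,
      inv k' v (galoisCohomology.map (j.restrictField (Place.Completion v)) 2 z) =
        (((inv k v z).val * (p ^ k' / p ^ k) : ℕ) : ZMod (p ^ k'))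

variable {E inv v}

/-- **Compatibility of the level pairings with the layer inclusions** `D_k ⊆ D_{k'}` (`k ≤ k'`):
`ι_{p^{k'}} ⟨(D_k ⊆ D_{k'})_* t', y_{k'}⟩_{p^{k'}} = ι_{p^k} ⟨t', y_k⟩_{p^k}`, under the level-change
law (cup-product functoriality = the tree's `zmodToQmodZ_localTatePairingZMod_map_eq_of_levelChange`,
with the dual transition `Hom(D_{k'}, μ_{p^{k'}}) → Hom(D_k, μ_{p^k})` of `E.dualSystem` and
`y_k = (y_{k'})|_{D_k}`). [cite: Greenberg2010, §3.1 (9) p. 14] [cite: MilneADT2006, Ch. I, Cor. 2.3] -/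
theorem levelPairing_localInclMap (hinv : InvLevelLaw inv v) {k k' : ℕ} (h : k ≤ k')
    (t' : galoisCohomology ((E.layerRep k).toLocal v) 1)
    (y : continuousCohomology 1 (E.localDualSystem v).limitRep.toTopRep) :
    E.levelPairing inv v k' (E.localInclMap v h t') y = E.levelPairing inv v k t' y := by
  haveI := E.finite k
  haveI := E.finite k'
  rw [levelPairing_apply, levelPairing_apply, ← E.map_dualRes_localProj v h y]
  exact zmodToQmodZ_localTatePairingZMod_map_eq_of_levelChange (E.layerRep k) (E.layerRep k')
    (pow_dvd_pow p h) (E.layerInclHom h).hom (E.dualSystem.redHom h).hom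
    (fun g m => E.muInclusion_dualRes_apply h g m) (muInclHom K (pow_dvd_pow p h)).hom
    (fun _ => rfl) v (inv k v) (inv k' v) (hinv h _ fun _ => rfl) t' (E.localProj v k' y)

/-- **The level pairing depends only on the class in `H¹(K_v, D)`**: two level representatives of the
same class pair identically with every `y` (they agree at a common deeper level, where
`levelPairing_localInclMap` applies). [cite: Greenberg2010, §3.1 (9) p. 14] -/
theorem levelPairing_eq_of_localSubtypeMap_eq (hinv : InvLevelLaw inv v) {k k' : ℕ}
    (t' : galoisCohomology ((E.layerRep k).toLocal v) 1)
    (t'' : galoisCohomology ((E.layerRep k').toLocal v) 1)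
    (h : E.localSubtypeMap v k t' = E.localSubtypeMap v k' t'')
    (y : continuousCohomology 1 (E.localDualSystem v).limitRep.toTopRep) :
    E.levelPairing inv v k t' y = E.levelPairing inv v k' t'' y := by
  obtain ⟨m, hkm, hk'm, hm⟩ := E.exists_localInclMap_eq v t' t'' h
  rw [← levelPairing_localInclMap hinv hkm t' y, ← levelPairing_localInclMap hinv hk'm t'' y, hm]

/-! ### §4. The pairing `H¹(K_v, D) × H¹_cont(K_v, T*) → ℚ/ℤ` -/

variable (E inv v)

/-- The pairing `t ↦ ⟪t, ·⟫` as a function of `t ∈ H¹(K_v, D)` (additive in `y`): the level pairing of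
a chosen level representative of `t` (well defined by `levelPairing_eq_of_localSubtypeMap_eq`; additive
in `t` under the level-change law, `limitPairing`). [cite: Greenberg2010, §2 (5) p. 6] -/
def limitPairingFun (t : galoisCohomology (τ.toLocal v) 1) :
    continuousCohomology 1 (E.localDualSystem v).limitRep.toTopRep →+ AddCircle (1 : ℚ) :=
  E.levelPairing inv v (E.exists_localSubtypeMap_eq v t).choose
    (E.exists_localSubtypeMap_eq v t).choose_spec.choose

variable {E inv v}

/-- **Level formula**: `⟪(D_k ⊆ D)_* t', y⟫ = ι_{p^k} ⟨t', y_k⟩_{p^k}`.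
[cite: Greenberg2010, §2 (5) p. 6, §3.1 (9) p. 14] -/
theorem limitPairingFun_localSubtypeMap (hinv : InvLevelLaw inv v) {k : ℕ}
    (t' : galoisCohomology ((E.layerRep k).toLocal v) 1)
    (y : continuousCohomology 1 (E.localDualSystem v).limitRep.toTopRep) :
    E.limitPairingFun inv v (E.localSubtypeMap v k t') y = E.levelPairing inv v k t' y :=
  levelPairing_eq_of_localSubtypeMap_eq hinv _ _
    (E.exists_localSubtypeMap_eq v _).choose_spec.choose_spec y

/-- `⟪·, y⟫` is additive in `t` (under the level-change law): two classes come from a common level,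
where the level pairing is additive. [cite: Greenberg2010, §2 (5) p. 6] -/
theorem limitPairingFun_add (hinv : InvLevelLaw inv v) (t₁ t₂ : galoisCohomology (τ.toLocal v) 1) :
    E.limitPairingFun inv v (t₁ + t₂) = E.limitPairingFun inv v t₁ + E.limitPairingFun inv v t₂ := by
  obtain ⟨k₁, t₁', rfl⟩ := E.exists_localSubtypeMap_eq v t₁
  obtain ⟨k₂, t₂', rfl⟩ := E.exists_localSubtypeMap_eq v t₂
  ext y
  rw [← E.localSubtypeMap_localInclMap v (le_max_left k₁ k₂) t₁',
    ← E.localSubtypeMap_localInclMap v (le_max_right k₁ k₂) t₂', ← map_add,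
    limitPairingFun_localSubtypeMap hinv, AddMonoidHom.add_apply, limitPairingFun_localSubtypeMap hinv,
    limitPairingFun_localSubtypeMap hinv, map_add, AddMonoidHom.add_apply,
    levelPairing_localInclMap hinv, levelPairing_localInclMap hinv]

/-- `⟪0, ·⟫ = 0`. [cite: Greenberg2010, §2 (5) p. 6] -/
theorem limitPairingFun_zero (hinv : InvLevelLaw inv v) : E.limitPairingFun inv v 0 = 0 := by
  ext y
  have h := limitPairingFun_localSubtypeMap (E := E) hinv (k := 0) 0 y
  simp only [map_zero, AddMonoidHom.zero_apply] at h ⊢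
  exact h

variable (E inv v) in
/-- **The `Λ`-adic local pairing `⟪t, y⟫ ∈ ℚ/ℤ` on `H¹(K_v, D) × H¹_cont(K_v, T*)`** (Greenberg's (5),
assembled from the local Tate pairings of the finite levels `D_k × Hom(D_k, μ_{p^k})`; bi-additive).
[cite: Greenberg2010, §2 (5) p. 6, §3.1 (9) p. 14] -/
def limitPairing (hinv : InvLevelLaw inv v) :
    galoisCohomology (τ.toLocal v) 1 →+
      continuousCohomology 1 (E.localDualSystem v).limitRep.toTopRep →+ AddCircle (1 : ℚ) where
  toFun := E.limitPairingFun inv v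
  map_zero' := limitPairingFun_zero hinv
  map_add' := limitPairingFun_add hinv

/-- Unfolding `limitPairing`. [cite: Greenberg2010, §2 (5) p. 6] -/
@[simp] theorem limitPairing_apply (hinv : InvLevelLaw inv v) (t : galoisCohomology (τ.toLocal v) 1) :
    E.limitPairing inv v hinv t = E.limitPairingFun inv v t := rfl

/-- **Level formula for `limitPairing`**: `⟪(D_k ⊆ D)_* t', y⟫ = ι_{p^k} ⟨t', y_k⟩_{p^k}`.
[cite: Greenberg2010, §2 (5) p. 6, §3.1 (9) p. 14] -/
theorem limitPairing_localSubtypeMap (hinv : InvLevelLaw inv v) {k : ℕ}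
    (t' : galoisCohomology ((E.layerRep k).toLocal v) 1)
    (y : continuousCohomology 1 (E.localDualSystem v).limitRep.toTopRep) :
    E.limitPairing inv v hinv (E.localSubtypeMap v k t') y = E.levelPairing inv v k t' y :=
  limitPairingFun_localSubtypeMap hinv t' y

/-! ### §5. Dual local conditions `L^⊥ ≤ H¹_cont(K_v, T*)` -/

variable (E inv v) in
/-- **The dual local condition `L^⊥ = {y | ⟪t, y⟫ = 0 ∀ t ∈ L}`** of a local condition
`L ≤ H¹(K_v, D)` — Greenberg's `L(K_v, T*)`, "orthogonal complements of each other under the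
pairing (9)" (§3.1). [cite: Greenberg2010, §3.1 p. 14] -/
def dualLocalCondition (L : AddSubgroup (galoisCohomology (τ.toLocal v) 1)) :
    AddSubgroup (continuousCohomology 1 (E.localDualSystem v).limitRep.toTopRep) where
  carrier := {y | ∀ t ∈ L, E.limitPairingFun inv v t y = 0}
  zero_mem' := fun t _ => by simp only [map_zero]
  add_mem' := fun {a b} ha hb t ht => by simp only [map_add, ha t ht, hb t ht, add_zero]
  neg_mem' := fun {a} ha t ht => by simp only [map_neg, ha t ht, neg_zero]

/-- Membership in `L^⊥`. [cite: Greenberg2010, §3.1 p. 14] -/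
@[simp] theorem mem_dualLocalCondition_iff (L : AddSubgroup (galoisCohomology (τ.toLocal v) 1))
    (y : continuousCohomology 1 (E.localDualSystem v).limitRep.toTopRep) :
    y ∈ E.dualLocalCondition inv v L ↔ ∀ t ∈ L, E.limitPairingFun inv v t y = 0 := Iff.rfl

/-- `L ↦ L^⊥` is antitone. [cite: Greenberg2010, §3.1 p. 14] -/
theorem dualLocalCondition_anti {L L' : AddSubgroup (galoisCohomology (τ.toLocal v) 1)} (h : L ≤ L') :
    E.dualLocalCondition inv v L' ≤ E.dualLocalCondition inv v L :=
  fun _ hy t ht => hy t (h ht)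

/-- `(0)^⊥ = H¹_cont(K_v, T*)`. [cite: Greenberg2010, §3.1 p. 14] -/
@[simp] theorem dualLocalCondition_bot (hinv : InvLevelLaw inv v) : E.dualLocalCondition inv v ⊥ = ⊤ := by
  rw [eq_top_iff]
  intro y _ t ht
  rw [AddSubgroup.mem_bot] at ht
  rw [ht, limitPairingFun_zero hinv, AddMonoidHom.zero_apply]

/-! ### §6. Right non-degeneracy in the limit at a finite place -/

/-- **At a finite place the pairing is non-degenerate on the `T*`-side**: if every `inv k` is a
perfect local Tate duality at the finite places (`LocalInvariants.IsPerfect`; the tree's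
`canonical_isPerfect`), then `⟪t, y⟫ = 0` for all `t ∈ H¹(K_w, D)` forces `y = 0` — levelwise
perfectness kills every component `y_k`, and `H¹_cont(K_w, T*) → lim_k H¹(K_w, Hom(D_k, μ_{p^k}))` is
injective (finite levels, König; the tree's `DiscreteInvSystem.toCohomologyLimit₁_injective`).
[cite: Greenberg2010, §3.1 p. 14] [cite: MilneADT2006, Ch. I, Cor. 2.3] -/
theorem eq_zero_of_forall_limitPairing_eq_zero {w : HeightOneSpectrum (𝓞 K)}
    (hinv : InvLevelLaw inv (Sum.inr w)) (hperf : ∀ k, (inv k).IsPerfect)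
    (y : continuousCohomology 1 (E.localDualSystem (Sum.inr w)).limitRep.toTopRep)
    (hy : ∀ t, E.limitPairing inv (Sum.inr w) hinv t y = 0) : y = 0 := by
  -- every level component `y_k` vanishes, by perfectness of the level-`k` pairing
  have hk : ∀ k, E.localProj (Sum.inr w) k y = 0 := by
    intro k
    haveI := E.finite k
    have hflip := ((hperf k w).2 (E.layerRep k) (fun m => E.pow_smul_eq_zero m)).2
    have h0 : (localTatePairingZMod (E.layerRep k) (p ^ k) (Sum.inr w) (inv k (Sum.inr w))).flip
        (E.localProj (Sum.inr w) k y) = 0 := by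
      refine AddMonoidHom.ext fun t' => ?_
      have h := hy (E.localSubtypeMap (Sum.inr w) k t')
      rw [limitPairing_localSubtypeMap hinv, levelPairing_apply] at h
      exact zmodToQmodZ_injective (p ^ k) (h.trans (map_zero _).symm)
    exact hflip.1 (h0.trans (map_zero _).symm)
  -- and `H¹_cont(K_w, T*) → lim_k H¹(K_w, Hom(D_k, μ_{p^k}))` is injective
  have hinj := (E.localDualSystem (Sum.inr w)).toCohomologyLimit₁_injective
    (E.dualSystem.comapChain _ E.chain) (fun k => E.finite_layerDual k)
  exact hinj ((Subtype.ext (funext fun k => hk k)).trans (map_zero _).symm)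

end DiscreteGaloisModule.TorsionLayers

end Literature.NumberTheory.GaloisRepresentations
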